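import Mathlib.Topology.Order.IntermediateValue
import Mathlib.Topology.Order.Compact
import Mathlib.Topology.MetricSpace.Pseudo.Lemmas
import Mathlib.Analysis.Normed.Order.Lattice
import HarnessLib

/-!
# A continuous locally injective function on an interval is injective

Topic: infrastructure (real analysis) for the coned fence collar: the height of a transversal arc
in a flow box is continuous and locally a homeomorphism germ of the parameter, hence injective on
the whole (short) parameter interval. **A function continuous on `[a, b]` and injective near
every point of `[a, b]` (within `[a, b]`) is injective on `[a, b]`**: otherwise between two
points with equal values it has an interior extremum, near which it takes equal values on both
sides (intermediate value theorem).

* `injOn_Icc_of_locally_injOn` (**proved**), `strictMonoOn_or_strictAntiOn_of_locally_injOn`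
  (**proved**).

All statements are [folklore].
-/

noncomputable section

open Set Filter Function
open scoped Topology

namespace Literature.Topology.FourManifolds

namespace CollarRadius

/-- Near an interior point where a continuous function attains its maximum on `[x, y]`, the
function is not injective: it takes a common value on both sides. [folklore] -/
theorem not_injOn_near_isMaxOn {f : ℝ → ℝ} {x c y : ℝ} (hxc : x < c) (hcy : c < y) (hf : ContinuousOn f (Icc x y))
    (hmax : ∀ z ∈ Icc x y, f z ≤ f c) {U : Set ℝ} (hU : U ∈ 𝓝 c)
    (hinj : InjOn f (U ∩ Icc x y)) : False := by
  -- shrink to `[c - δ, c + δ] ⊆ U ∩ [x, y]`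
  obtain ⟨δ₀, hδ₀, hball⟩ := Metric.mem_nhds_iff.1 hU
  set δ := min (δ₀ / 2) (min (c - x) (y - c)) with hδ
  have hδpos : 0 < δ := lt_min (by linarith) (lt_min (by linarith) (by linarith))
  have hδU : Icc (c - δ) (c + δ) ⊆ U := fun z hz ↦ hball (by
    rw [Metric.mem_ball, Real.dist_eq, abs_lt]
    have h1 := min_le_left (δ₀ / 2) (min (c - x) (y - c))
    constructor <;> linarith [hz.1, hz.2])
  have hδI : Icc (c - δ) (c + δ) ⊆ Icc x y := fun z hz ↦ by
    have h1 := min_le_right (δ₀ / 2) (min (c - x) (y - c))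
    have h2 := min_le_left (c - x) (y - c); have h3 := min_le_right (c - x) (y - c)
    exact ⟨by linarith [hz.1], by linarith [hz.2]⟩
  -- values at `c ± δ` are `< f c` unless injectivity already fails
  have hleft_mem : c - δ ∈ Icc x y := hδI ⟨le_rfl, by linarith⟩
  have hright_mem : c + δ ∈ Icc x y := hδI ⟨by linarith, le_rfl⟩
  have hc_mem : c ∈ Icc x y := ⟨hxc.le, hcy.le⟩
  have hlt_left : f (c - δ) < f c := by
    rcases (hmax _ hleft_mem).lt_or_eq with h | h
    · exact h
    · exfalso
      have := hinj ⟨hδU ⟨le_rfl, by linarith⟩, hleft_mem⟩ ⟨hδU ⟨by linarith, by linarith⟩, hc_mem⟩ h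
      linarith
  have hlt_right : f (c + δ) < f c := by
    rcases (hmax _ hright_mem).lt_or_eq with h | h
    · exact h
    · exfalso
      have := hinj ⟨hδU ⟨by linarith, le_rfl⟩, hright_mem⟩ ⟨hδU ⟨by linarith, by linarith⟩, hc_mem⟩ h
      linarith
  -- the common value `v`
  set v := max (f (c - δ)) (f (c + δ)) with hv
  have hvlt : v < f c := max_lt hlt_left hlt_right
  -- attained on the left and on the right of `c`
  have hcl : ContinuousOn f (Icc (c - δ) c) := hf.mono ((Icc_subset_Icc_right (by linarith)).trans hδI)
  have hcr : ContinuousOn f (Icc c (c + δ)) := hf.mono ((Icc_subset_Icc_left (by linarith)).trans hδI)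
  obtain ⟨z₁, hz₁, hfz₁⟩ : ∃ z₁ ∈ Icc (c - δ) c, f z₁ = v :=
    intermediate_value_Icc (by linarith) hcl ⟨le_max_left _ _, hvlt.le⟩
  obtain ⟨z₂, hz₂, hfz₂⟩ : ∃ z₂ ∈ Icc c (c + δ), f z₂ = v :=
    intermediate_value_Icc' (by linarith) hcr ⟨le_max_right _ _, hvlt.le⟩
  have hz₁c : z₁ < c := by
    rcases hz₁.2.lt_or_eq with h | h
    · exact h
    · rw [h] at hfz₁; linarith
  have hz₂c : c < z₂ := by
    rcases hz₂.1.lt_or_eq with h | h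
    · exact h
    · rw [← h] at hfz₂; linarith
  have heq : z₁ = z₂ := hinj ⟨hδU ⟨hz₁.1, by linarith [hz₁.2]⟩, hδI ⟨hz₁.1, by linarith [hz₁.2]⟩⟩
    ⟨hδU ⟨by linarith [hz₂.1], hz₂.2⟩, hδI ⟨by linarith [hz₂.1], hz₂.2⟩⟩ (hfz₁.trans hfz₂.symm)
  linarith

/-- **A function continuous on `[a, b]` and injective near each of its points (within `[a, b]`)
is injective on `[a, b]`.** [folklore] -/
theorem injOn_Icc_of_locally_injOn {f : ℝ → ℝ} {a b : ℝ} (hf : ContinuousOn f (Icc a b))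
    (hloc : ∀ c ∈ Icc a b, ∃ U ∈ 𝓝 c, InjOn f (U ∩ Icc a b)) : InjOn f (Icc a b) := by
  -- it suffices to treat `x < y`
  suffices H : ∀ x ∈ Icc a b, ∀ y ∈ Icc a b, x < y → f x = f y → False by
    intro x hx y hy hxy
    by_contra hne
    rcases lt_or_gt_of_ne hne with h | h
    · exact H x hx y hy h hxy
    · exact H y hy x hx h hxy.symm
  intro x hx y hy hxy hfxy
  have hsub : Icc x y ⊆ Icc a b := Icc_subset_Icc hx.1 hy.2
  have hfc : ContinuousOn f (Icc x y) := hf.mono hsub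
  have hne : (Icc x y).Nonempty := nonempty_Icc.2 hxy.le
  obtain ⟨cM, hcM, hMax⟩ := isCompact_Icc.exists_isMaxOn hne hfc
  obtain ⟨cm, hcm, hMin⟩ := isCompact_Icc.exists_isMinOn hne hfc
  by_cases hconst : ∀ z ∈ Icc x y, f z = f x
  · -- constant on `[x, y]`: not injective near `x`
    obtain ⟨U, hU, hinj⟩ := hloc x (hsub ⟨le_rfl, hxy.le⟩)
    obtain ⟨δ₀, hδ₀, hball⟩ := Metric.mem_nhds_iff.1 hU
    set z := x + min (δ₀ / 2) (y - x) with hz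
    have hzU : z ∈ U := hball (by
      rw [Metric.mem_ball, Real.dist_eq, hz, add_sub_cancel_left, abs_of_pos (lt_min (by linarith) (by linarith))]
      have := min_le_left (δ₀ / 2) (y - x); linarith)
    have hzI : z ∈ Icc x y := ⟨by have := lt_min (by linarith : 0 < δ₀ / 2) (sub_pos.2 hxy); rw [hz]; linarith,
      by have := min_le_right (δ₀ / 2) (y - x); rw [hz]; linarith⟩
    have h := hinj ⟨mem_of_mem_nhds hU, hsub ⟨le_rfl, hxy.le⟩⟩ ⟨hzU, hsub hzI⟩ (hconst z hzI).symm
    have : 0 < min (δ₀ / 2) (y - x) := lt_min (by linarith) (by linarith)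
    rw [hz] at h; linarith
  · push Not at hconst
    obtain ⟨z, hz, hfz⟩ := hconst
    rcases lt_or_gt_of_ne hfz with hlt | hgt
    · -- a minimum below `f x = f y`: interior; apply the max version to `-f`
      have hmlt : f cm < f x := lt_of_le_of_lt (hMin hz) hlt
      have hcmx : x < cm := by
        rcases hcm.1.lt_or_eq with h | h
        · exact h
        · rw [← h] at hmlt; exact absurd hmlt (lt_irrefl _)
      have hcmy : cm < y := by
        rcases hcm.2.lt_or_eq with h | h
        · exact h
        · rw [h, ← hfxy] at hmlt; exact absurd hmlt (lt_irrefl _)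
      obtain ⟨U, hU, hinj⟩ := hloc cm (hsub hcm)
      refine not_injOn_near_isMaxOn (f := fun t ↦ -f t) hcmx hcmy (Continuous.comp_continuousOn continuous_neg hfc) (fun w hw ↦ neg_le_neg (hMin hw)) hU ?_
      intro p hp q hq hpq
      exact hinj ⟨hp.1, hsub hp.2⟩ ⟨hq.1, hsub hq.2⟩ (neg_injective hpq)
    · have hMgt : f x < f cM := lt_of_lt_of_le hgt (hMax hz)
      have hcMx : x < cM := by
        rcases hcM.1.lt_or_eq with h | h
        · exact h
        · rw [← h] at hMgt; exact absurd hMgt (lt_irrefl _)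
      have hcMy : cM < y := by
        rcases hcM.2.lt_or_eq with h | h
        · exact h
        · rw [h, ← hfxy] at hMgt; exact absurd hMgt (lt_irrefl _)
      obtain ⟨U, hU, hinj⟩ := hloc cM (hsub hcM)
      exact not_injOn_near_isMaxOn hcMx hcMy hfc (fun w hw ↦ hMax hw) hU
        fun p hp q hq hpq ↦ hinj ⟨hp.1, hsub hp.2⟩ ⟨hq.1, hsub hq.2⟩ hpq

/-- A function continuous on `[a, b]` and locally injective is strictly monotone or strictly
antitone on `[a, b]`. [folklore] -/
theorem strictMonoOn_or_strictAntiOn_of_locally_injOn {f : ℝ → ℝ} {a b : ℝ} (hab : a ≤ b) (hf : ContinuousOn f (Icc a b))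
    (hloc : ∀ c ∈ Icc a b, ∃ U ∈ 𝓝 c, InjOn f (U ∩ Icc a b)) :
    StrictMonoOn f (Icc a b) ∨ StrictAntiOn f (Icc a b) :=
  hf.strictMonoOn_of_injOn_Icc' hab (injOn_Icc_of_locally_injOn hf hloc)

end CollarRadius

end Literature.Topology.FourManifolds
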